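import Summits.Ventures.HodgeRepro2.T5CyclotomicDyadic
import Summits.Ventures.HodgeRepro2.T5TameCongruence

/-!
# T5SexticDecomposition — splitting in the sextic field against splitting in its subfields

Seat p3 of the blind cell `pub-hodge-repro2` (Tier-5 support column for sub-step N2 of
`route/TIER5.md`).  A kernel witness behind row N2.2.5 of `route/T5-N2-route-3.md`: «a place of
`F⁺` above `p` is non-split in `E` iff `c ∈ D_p` iff `Frob_p` has even order iff `p` does NOT split in
the imaginary quadratic subfield `K`» — here the first and the last member of that chain are shown
equivalent at the level of the number fields (the decomposition-group reading of T4A §3.2 is the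
same statement in group-theoretic clothing).

Setting: number fields `F ⊆ E` and `K ⊆ E` with `E/F` Galois of degree `2`, `E/K` Galois of degree
`3`, `F/ℚ` Galois of degree `3` and `K/ℚ` Galois of degree `2` — the sextic CM field with its cubic
totally real and its imaginary quadratic subfield; cyclicity of `Gal(E/ℚ)` is not needed beyond
these four facts.  For a prime `P` of `𝓞 E` above a rational prime `p`, with `w := P ∩ 𝓞 F` and
`𝔮 := P ∩ 𝓞 K`:

* `f(P ∣ p) = f(w ∣ p) · f(P ∣ w) = f(𝔮 ∣ p) · f(P ∣ 𝔮)` with `f(w ∣ p) ∣ 3`, `f(P ∣ 𝔮) ∣ 3`,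
  `f(P ∣ w) ∣ 2`, `f(𝔮 ∣ p) ∣ 2`, hence `2 ∣ f(P ∣ p) ⟺ f(P ∣ w) = 2 ⟺ f(𝔮 ∣ p) = 2`
  (`inertiaDeg_eq_two_iff`);
* if `p` is unramified in `E`, then `w` is non-split in `E` (exactly one prime of `E` above `w`)
  if and only if `p` is inert in `K` (exactly one prime of `K` above `p`)
  (`ncard_primesOver_eq_one_iff`), by the Galois identities `g · e · f = 2` for `E/F` at `w`
  and for `K/ℚ` at `p`.

The two earlier witnesses `T5CyclotomicDyadic` (the fundamental identity over `𝓞 F`) and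
`T5TameCongruence` (the fundamental identity over `ℤ`) are imported, not restated.

Declaration of README §8(d): this file uses an L-value-free non-vanishing device: NO.
-/

namespace Summit.Ventures.HodgeRepro2.T5SexticDecomposition

open NumberField Ideal

section base

variable {F : Type*} [Field F] [NumberField F] [IsGalois ℚ F]

/-- In a Galois number field, the inertia degree of a prime above `p` divides the degree. -/
theorem inertiaDeg_dvd_finrank {p : ℕ} (hp : p.Prime)
    (P : Ideal (𝓞 F)) [P.IsPrime] [P.LiesOver (span {(p : ℤ)})] :
    P.inertiaDeg ℤ ∣ Module.finrank ℚ F := by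
  refine ⟨((span {(p : ℤ)}).primesOver (𝓞 F)).ncard * P.ramificationIdx ℤ, ?_⟩
  rw [← T5TameCongruence.ncard_primesOver_mul_ramificationIdx_mul_inertiaDeg hp P]; ring

/-- In a Galois number field, an unramified prime `P` above `p` is the only prime above `p`
(`p` is «non-split») exactly when its inertia degree is the full degree. -/
theorem ncard_primesOver_eq_one_iff_inertiaDeg_eq_finrank {p : ℕ} (hp : p.Prime)
    (P : Ideal (𝓞 F)) [P.IsPrime] [P.LiesOver (span {(p : ℤ)})] (he : P.ramificationIdx ℤ = 1) :
    ((span {(p : ℤ)}).primesOver (𝓞 F)).ncard = 1 ↔ P.inertiaDeg ℤ = Module.finrank ℚ F := by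
  have h := T5TameCongruence.ncard_primesOver_mul_ramificationIdx_mul_inertiaDeg hp P
  rw [he, one_mul] at h
  constructor
  · intro hg; rw [← h, hg, one_mul]
  · intro hf
    have hpos : 0 < Module.finrank ℚ F := Module.finrank_pos
    rw [hf] at h
    have : ((span {(p : ℤ)}).primesOver (𝓞 F)).ncard * Module.finrank ℚ F =
        1 * Module.finrank ℚ F := by rw [h, one_mul]
    exact Nat.eq_of_mul_eq_mul_right hpos this

end base

section relative

variable {F E : Type*} [Field F] [NumberField F] [Field E] [NumberField E] [Algebra F E]
  [IsGalois F E]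

/-- In a Galois extension of number fields, a prime `P` of `𝓞 E` unramified over `𝔭 = P ∩ 𝓞 F` is
the only prime above `𝔭` exactly when its inertia degree over `𝓞 F` is the full relative degree. -/
theorem ncard_primesOver_eq_one_iff_inertiaDeg_eq_finrank_rel (𝔭 : Ideal (𝓞 F)) [𝔭.IsPrime]
    (P : Ideal (𝓞 E)) [P.IsPrime] [P.LiesOver 𝔭] (he : P.ramificationIdx (𝓞 F) = 1) :
    (𝔭.primesOver (𝓞 E)).ncard = 1 ↔ P.inertiaDeg (𝓞 F) = Module.finrank F E := by
  have h := T5CyclotomicDyadic.ncard_primesOver_mul 𝔭 P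
  rw [he, one_mul] at h
  constructor
  · intro hg; rw [← h, hg, one_mul]
  · intro hf
    have hpos : 0 < Module.finrank F E := Module.finrank_pos
    rw [hf] at h
    have : (𝔭.primesOver (𝓞 E)).ncard * Module.finrank F E = 1 * Module.finrank F E := by
      rw [h, one_mul]
    exact Nat.eq_of_mul_eq_mul_right hpos this

end relative

section sextic

variable {F K E : Type*} [Field F] [NumberField F] [Field K] [NumberField K] [Field E]
  [NumberField E] [Algebra F E] [Algebra K E] [IsGalois F E] [IsGalois K E]
  [IsGalois ℚ F] [IsGalois ℚ K]
  (hFE : Module.finrank F E = 2) (hKE : Module.finrank K E = 3)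
  (hF : Module.finrank ℚ F = 3) (hK : Module.finrank ℚ K = 2)
  {p : ℕ} (hp : p.Prime) (P : Ideal (𝓞 E)) [P.IsPrime] [P.LiesOver (span {(p : ℤ)})]

include hFE hF hp in
/-- Parity of the inertia degree, read through the cubic subfield: `2 ∣ f(P ∣ p)` iff
`f(P ∣ w) = 2` for `w = P ∩ 𝓞 F`. -/
theorem two_dvd_inertiaDeg_iff_cubic :
    2 ∣ P.inertiaDeg ℤ ↔ P.inertiaDeg (𝓞 F) = 2 := by
  have htower : P.inertiaDeg ℤ = (P.under (𝓞 F)).inertiaDeg ℤ * P.inertiaDeg (𝓞 F) :=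
    inertiaDeg_tower (P.under (𝓞 F)) P
  have hw : (P.under (𝓞 F)).inertiaDeg ℤ ∣ 3 := by
    rw [← hF]; exact inertiaDeg_dvd_finrank hp (P.under (𝓞 F))
  have hPw : P.inertiaDeg (𝓞 F) ∣ 2 := by
    rw [← hFE]; exact T5CyclotomicDyadic.inertiaDeg_dvd_finrank_of_isGalois (P.under (𝓞 F)) P
  have hpos : 0 < P.inertiaDeg (𝓞 F) := P.inertiaDeg_pos (𝓞 F)
  constructor
  · intro h2
    rw [htower] at h2
    have hodd : ¬ 2 ∣ (P.under (𝓞 F)).inertiaDeg ℤ := fun h =>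
      absurd (h.trans hw) (by norm_num)
    have h2' : 2 ∣ P.inertiaDeg (𝓞 F) :=
      (Nat.Prime.dvd_mul Nat.prime_two).mp h2 |>.resolve_left hodd
    exact Nat.le_antisymm (Nat.le_of_dvd (by norm_num) hPw) (Nat.le_of_dvd hpos h2')
  · intro h2
    rw [htower, h2]
    exact Dvd.intro_left _ rfl

include hKE hK hp in
/-- Parity of the inertia degree, read through the quadratic subfield: `2 ∣ f(P ∣ p)` iff
`f(𝔮 ∣ p) = 2` for `𝔮 = P ∩ 𝓞 K`. -/
theorem two_dvd_inertiaDeg_iff_quadratic :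
    2 ∣ P.inertiaDeg ℤ ↔ (P.under (𝓞 K)).inertiaDeg ℤ = 2 := by
  have htower : P.inertiaDeg ℤ = (P.under (𝓞 K)).inertiaDeg ℤ * P.inertiaDeg (𝓞 K) :=
    inertiaDeg_tower (P.under (𝓞 K)) P
  have hq : (P.under (𝓞 K)).inertiaDeg ℤ ∣ 2 := by
    rw [← hK]; exact inertiaDeg_dvd_finrank hp (P.under (𝓞 K))
  have hPq : P.inertiaDeg (𝓞 K) ∣ 3 := by
    rw [← hKE]; exact T5CyclotomicDyadic.inertiaDeg_dvd_finrank_of_isGalois (P.under (𝓞 K)) P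
  have hpos : 0 < (P.under (𝓞 K)).inertiaDeg ℤ := (P.under (𝓞 K)).inertiaDeg_pos ℤ
  constructor
  · intro h2
    rw [htower] at h2
    have hodd : ¬ 2 ∣ P.inertiaDeg (𝓞 K) := fun h => absurd (h.trans hPq) (by norm_num)
    have h2' : 2 ∣ (P.under (𝓞 K)).inertiaDeg ℤ :=
      (Nat.Prime.dvd_mul Nat.prime_two).mp h2 |>.resolve_right hodd
    exact Nat.le_antisymm (Nat.le_of_dvd (by norm_num) hq) (Nat.le_of_dvd hpos h2')
  · intro h2
    rw [htower, h2]
    exact Dvd.intro _ rfl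

include hFE hKE hF hK hp in
/-- **The decomposition dictionary of the sextic field** (row N2.2.5, inertia-degree form):
`f(P ∣ w) = 2` for the place `w = P ∩ 𝓞 F` of the cubic subfield iff `f(𝔮 ∣ p) = 2` for the place
`𝔮 = P ∩ 𝓞 K` of the quadratic subfield. -/
theorem inertiaDeg_eq_two_iff :
    P.inertiaDeg (𝓞 F) = 2 ↔ (P.under (𝓞 K)).inertiaDeg ℤ = 2 := by
  rw [← two_dvd_inertiaDeg_iff_cubic hFE hF hp P, two_dvd_inertiaDeg_iff_quadratic hKE hK hp P]

include hFE hKE hF hK hp in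
/-- **The decomposition dictionary of the sextic field** (row N2.2.5, splitting form).  Let `p` be
unramified in `E`.  Then the place `w = P ∩ 𝓞 F` of the cubic subfield is NON-SPLIT in `E`
(exactly one prime of `𝓞 E` above `w`) if and only if `p` is INERT in the quadratic subfield `K`
(exactly one prime of `𝓞 K` above `p`): «a place of `F⁺` above `p` is non-split in `E` iff `p` does
not split in `K`». -/
theorem ncard_primesOver_eq_one_iff (he : P.ramificationIdx ℤ = 1) :
    ((P.under (𝓞 F)).primesOver (𝓞 E)).ncard = 1 ↔
      ((span {(p : ℤ)}).primesOver (𝓞 K)).ncard = 1 := by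
  have heF : P.ramificationIdx (𝓞 F) = 1 :=
    (T5CyclotomicDyadic.ramificationIdx_eq_one_of_tower (P.under (𝓞 F)) P he).2
  have heK : (P.under (𝓞 K)).ramificationIdx ℤ = 1 :=
    (T5CyclotomicDyadic.ramificationIdx_eq_one_of_tower (P.under (𝓞 K)) P he).1
  rw [ncard_primesOver_eq_one_iff_inertiaDeg_eq_finrank_rel (P.under (𝓞 F)) P heF, hFE,
    ncard_primesOver_eq_one_iff_inertiaDeg_eq_finrank hp (P.under (𝓞 K)) heK, hK]
  exact inertiaDeg_eq_two_iff hFE hKE hF hK hp P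

include hFE hKE hF hK hp in
/-- The same dictionary, negated: `w` splits in `E` iff `p` splits in `K` (both for `p` unramified
in `E`). -/
theorem ncard_primesOver_eq_two_iff (he : P.ramificationIdx ℤ = 1) :
    ((P.under (𝓞 F)).primesOver (𝓞 E)).ncard = 2 ↔
      ((span {(p : ℤ)}).primesOver (𝓞 K)).ncard = 2 := by
  have heF : P.ramificationIdx (𝓞 F) = 1 :=
    (T5CyclotomicDyadic.ramificationIdx_eq_one_of_tower (P.under (𝓞 F)) P he).2
  have heK : (P.under (𝓞 K)).ramificationIdx ℤ = 1 :=
    (T5CyclotomicDyadic.ramificationIdx_eq_one_of_tower (P.under (𝓞 K)) P he).1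
  have h1 := T5CyclotomicDyadic.ncard_primesOver_mul (P.under (𝓞 F)) P
  have h2 := T5TameCongruence.ncard_primesOver_mul_ramificationIdx_mul_inertiaDeg hp
    (P.under (𝓞 K))
  rw [heF, one_mul, hFE] at h1
  rw [heK, one_mul, hK] at h2
  have key := ncard_primesOver_eq_one_iff hFE hKE hF hK hp P he
  have hfw : P.inertiaDeg (𝓞 F) ∣ 2 := Dvd.intro_left _ h1
  have hfq : (P.under (𝓞 K)).inertiaDeg ℤ ∣ 2 := Dvd.intro_left _ h2
  have hgw : ((P.under (𝓞 F)).primesOver (𝓞 E)).ncard ∣ 2 := Dvd.intro _ h1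
  have hgq : ((span {(p : ℤ)}).primesOver (𝓞 K)).ncard ∣ 2 := Dvd.intro _ h2
  have hgw' : ((P.under (𝓞 F)).primesOver (𝓞 E)).ncard = 1 ∨
      ((P.under (𝓞 F)).primesOver (𝓞 E)).ncard = 2 :=
    Nat.prime_two.eq_one_or_self_of_dvd _ hgw
  have hgq' : ((span {(p : ℤ)}).primesOver (𝓞 K)).ncard = 1 ∨
      ((span {(p : ℤ)}).primesOver (𝓞 K)).ncard = 2 :=
    Nat.prime_two.eq_one_or_self_of_dvd _ hgq
  constructor
  · intro h
    rcases hgq' with h' | h'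
    · have := key.mpr h'; omega
    · exact h'
  · intro h
    rcases hgw' with h' | h'
    · have := key.mp h'; omega
    · exact h'

end sextic

end Summit.Ventures.HodgeRepro2.T5SexticDecomposition
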